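import Summits.Parity.GeneralizedHardyLittlewood.Theorems.LeeYangFibresPrimeCellsRelativeChowlaDefs
import Summits.Parity.GeneralizedHardyLittlewood.Theorems.LeeYangFibresPrimeCellsRelativeWalshExtraction
import Summits.Parity.GeneralizedHardyLittlewood.Theorems.LeeYangFibresPrimeCellsRelativeSingletonClassSums
import Summits.Parity.GeneralizedHardyLittlewood.Theorems.LeeYangFibresPrimeCellsRelativeWeightedFromMeanPos
import Summits.Parity.GeneralizedHardyLittlewood.Theorems.LeeYangFibresPrimeCellsRelativeChowlaClipsParityPos
import Summits.Parity.GeneralizedHardyLittlewood.Theorems.LeeYangFibresPrimeCellsRelativeSieveTransfer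
import Summits.Parity.GeneralizedHardyLittlewood.Theorems.LeeYangFibresAbsoluteUpgradeRoughAnatomy
import Summits.Parity.GeneralizedHardyLittlewood.Theorems.LeeYangFibresModelCellFacts
import Summits.Parity.GeneralizedHardyLittlewood.Theorems.LeeYangFibresPrimeCellsRelativeSieveOutToChowla
import Summits.Parity.GeneralizedHardyLittlewood.Theorems.LeeYangFibresPrimeCellsRelativeSieveOutToChowlaAt
import Summits.Parity.GeneralizedHardyLittlewood.Theorems.LeeYangFibresPrimeCellsRelativeChowlaHardness
import HarnessLib

/-!
# Crux `PrimeCellsRelative` (stmt-Parity-14112) — line `SketchIdeator4` (card `sieve-out-to-chowla`), skeleton v6 (lead c6-0)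

`PrimeCellsRelative` (route `LeeYangFibres`, sub-problem `GeneralizedHardyLittlewood`): the counting form of
Dickson–Hardy–Littlewood for the joint rough PRIME cell of a `d = 1` system with Green–Tao's Conj. 1.4 error shape.
Skeleton of the line built from the round-2 crux idea card `Cruxes/PrimeCellsRelative/Ideas/sieve-out-to-chowla.md`
(ideator 4), reshaped by the line lead `prover-line-stmt-Parity-14112-a1-0` (2026-08-16) onto the sibling crux
`AbsoluteUpgrade`'s landed sieve/Walsh vocabulary and the line's own vocabulary file
`Theorems/LeeYangFibresPrimeCellsRelativeChowlaDefs.lean` (p116544; statement types of every stub below).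
v4 (final, after the reshape and wave 2): ALL FIVE provable stubs are LANDED and imported; the skeleton's own copies live
in the sub-namespace `…SieveOutToChowla.Skeleton` and are one-line references to the landed theorems (registered names and
signatures unchanged); the only `sorry`s left are the two CONJECTURAL stubs (`stub_cellParityLaw` = item stmt-Parity-14109,
`stub_liouvilleTupleMeanPos` = the new parity input), and the line's theorem
`primeCellsRelative_of_cellParityLaw_of_liouvilleTupleMeanPos : CellParityLaw → (∀ t ≥ 2, LiouvilleTupleMeanPos t) →
PrimeCellsRelative` is LANDED sorry-free (Theorems/LeeYangFibresPrimeCellsRelativeSieveOutToChowla.lean, p119571).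
RESHAPE (≈18:05Z): the first-registration input `LiouvilleTupleMean t` (all intervals) is FALSE for `t ≥ 2` — forms negative on
the interval give sign `+1`, no cancellation (`not_liouvilleTupleMean_two`, p119545) —; the corrected `LiouvilleTupleMeanPos`
(every form `≥ 1` on the interval, which the sieve transfer supplies) replaces it, with `stub_weightedFromMeanPos` (p119356)
and `stub_chowlaClipsParityPos` (p119358).

v5/v6 (continuation lead `prover-line-stmt-Parity-14112-c6-0`, 2026-08-16): no provable registered stub was open, so the seat
certified the INPUT and sharpened the OUTPUT, all LANDED `--supports`: the hardness certificate
`chowlaConjecture_of_liouvilleTupleMeanPos : (∀ t ≥ 2, LiouvilleTupleMeanPos t) → ChowlaConjecture` (parity.S06; p120414 —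
the promoted stub is conjecture-grade by a theorem); the `t`-slices `CellParityLawAt` / `PrimeCellsRelativeAt` (ChowlaDefs append 3,
p120597) and the `t`-LOCAL line theorem `primeCellsRelativeAt_of_cellParityLawAt : ∀ t ≥ 1, CellParityLawAt t → LiouvilleTupleMeanPos t
→ PrimeCellsRelativeAt t` (p121321, used below as `PrimeCellsRelative_of''`); the cross-route bridge
`liouvilleTupleMeanPos_two_of_relativeChowlaLevel` (p121142: at `t = 2` the parity input is route `LiouvilleOpening`'s crux
`RelativeChowlaLevel`, stmt-Parity-16148, plus log-power natural pair Chowla); `twinPrimeConjecture_of_primeCellsRelativeAt_two`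
(p121518) and the PAIR PACKAGE `primeCellsRelativeAt_two_of_pairInputs : CellParityLawAt 2 → RelativeChowlaLevel → (log-power pair
Chowla) → PrimeCellsRelativeAt 2 ⟹ twins` (p121662).  The two `sorry`s are unchanged and conjectural by design.

## The line in one paragraph

The joint `N^{1/u}`-rough tuples are the disjoint union of the route's `Ω`-cells `C_j`, `j ∈ [1,u]^t`, and
`λ(ψ_i(n)) = (−1)^{j_i}` is constant on a cell, so the rough-restricted correlation `E_S = Σ_rough ∏_{i∈S} λ(ψ_i(n))`
is the SIGNED SUM OF ALL CELLS; Walsh inversion of `CellParityLaw` (crux 3) gives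
`|θ_S| M Â^t ≤ |E_S| + 2^{t+1}|Ã| Â^{t-1} M + u^t E` (`stub_walshExtraction`, LANDED p118325).  Sieving OUT the signed
sequence (sign split + two Fundamental Lemmas in dimension `t` at level `z^s`, main terms cancel: helper
`signed_sifted_sum_le_of_sign`, LANDED p117004) bounds `|E_S|` by `C e^{-s} M (u/log N)^t` plus class sums of the sign
along progressions of squarefree modulus `≤ N^{2s/u}` (`stub_sieveTransfer`, any `±1` weight; LANDED p118887).  Singleton class
sums are small by Bombieri–Vinogradov for `λ` (`stub_singletonClassSums`, LANDED p117580); for `|S| ≥ 2` their smallness is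
the line's ONE conjectural input `LiouvilleTupleMeanPos` (`stub_liouvilleTupleMeanPos`; BV-mean `k`-point Chowla at level `N^η`,
natural density, forms ≥ 1 on the interval, no primes), put in weighted root-class form by Cauchy–Schwarz (`stub_weightedFromMeanPos`, LANDED p119356).
With `RoughAnatomy` (LANDED p97352) and `ModelCellFacts` (PROVED, item 14111) every loss is a constant killed in the order
`ε → δ → ε_M → u₀ → c → C → s → η → u → ε_law → N₀`, and the prime cell follows with the crux's relative + absolute error
(`stub_chowlaClipsParityPos`, LANDED p119358, arithmetic helper p117542).  The other conjectural stub is crux 3 itself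
(`stub_cellParityLaw` = item stmt-Parity-14109 verbatim): this line is the SECOND IN-ARROW to the node,
`CellParityLaw ∧ LiouvilleTupleMeanPos ⟹ PrimeCellsRelative` (LANDED p119571), parallel to the proved `HyperbolicityClipsParity` (p96058).

## Disproof used (Cruxes/PrimeCellsRelative/Disproof.lean v3, cdisprove, NO KILL)

Every `_false_without_` entry is honoured by construction: the absolute term `N/log^t N` is USED (law cell errors, junk
`N/log^{t+1} N` of the transfer, class-sum bounds — `primeCellsRelative_false_without_absoluteError`, p98015); the size bound
enters every statement as `∀ L … ∃ N₀` (`_without_sizeBound`, p99402); non-degeneracy gives the sieve dimension of `F_Ψ` and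
`a_k ≠ 0` (`_without_nondegeneracy`, p99898); box containment + convexity make `K ∩ {Ψ ≥ 1} ∩ ℤ` an interval (`_without_box…`,
`_without_convexity`, p100396/p100495).  Targets: none registered against this line.  The Siegel guard is consistent
(`LiouvilleTupleMeanPos` fails at `h ∈ q₀ℤ` under an exceptional zero, exactly where the crux fails).  No stub is the crux (O1).
Tightness in the line's own vocabulary: positivity of the forms is load-bearing (`not_liouvilleTupleMean_two`, p119545).

## Stubs (7, registered) and composition

LANDED: `stub_sieveTransfer` (p118887), `stub_walshExtraction` (p118325), `stub_singletonClassSums` (p117580),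
`stub_weightedFromMeanPos` (p119356), `stub_chowlaClipsParityPos` (p119358); conjectural: `stub_cellParityLaw`
(= stmt-Parity-14109), `stub_liouvilleTupleMeanPos` (crux-2′ candidate); `PrimeCellsRelative_of : PrimeCellsRelative`.
-/

noncomputable section

open scoped BigOperators Classical
open Finset Filter

namespace Summit.Parity.GeneralizedHardyLittlewood.Cruxes.PrimeCellsRelative.SieveOutToChowla.Skeleton

open Literature.NumberTheory.Sieve
open Summit.Parity.GeneralizedHardyLittlewood.Theses.LeeYangFibres
open Summit.Parity.GeneralizedHardyLittlewood.Cruxes.AbsoluteUpgrade.NlcCellsAbsoluteClip (RoughAnatomy)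
open Summit.Parity.GeneralizedHardyLittlewood.Cruxes.PrimeCellsRelative.SieveOutToChowla

/-! ## Stubs (registered; `sorry` only in the open ones) -/

/-- **Stub 1 — LANDED** (p118887, `Theorems/LeeYangFibresPrimeCellsRelativeSieveTransfer.lean`; the lead's).
[cite: FriedlanderIwaniecOpera2010, Cor. 6.10] -/
theorem stub_sieveTransfer : SieveTransfer :=
  SieveOutToChowla.stub_sieveTransfer

/-- **Stub 2 — LANDED** (p118325, `Theorems/LeeYangFibresPrimeCellsRelativeWalshExtraction.lean`). [folklore] -/
theorem stub_walshExtraction : WalshExtraction :=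
  SieveOutToChowla.stub_walshExtraction

/-- **Stub 3 — LANDED** (p117580, `Theorems/LeeYangFibresPrimeCellsRelativeSingletonClassSums.lean`).
[cite: IwaniecKowalski2004, Thm. 17.4] -/
theorem stub_singletonClassSums : SingletonClassSums :=
  SieveOutToChowla.stub_singletonClassSums

/-- **Stub 4 — LANDED** (p119356, `Theorems/LeeYangFibresPrimeCellsRelativeWeightedFromMeanPos.lean`). [folklore] -/
theorem stub_weightedFromMeanPos : ∀ t : ℕ, LiouvilleTupleMeanPos t → WeightedTupleClassSumsPos t :=
  SieveOutToChowla.stub_weightedFromMeanPos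

/-- **Stub 5 — LANDED** (p119358, `Theorems/LeeYangFibresPrimeCellsRelativeChowlaClipsParityPos.lean`, with the arithmetic
helper p117542). [folklore] -/
theorem stub_chowlaClipsParityPos : ChowlaClipsParityPos :=
  SieveOutToChowla.stub_chowlaClipsParityPos

/-- **Stub 6 (conjectural input = the route's crux 3, item stmt-Parity-14109 VERBATIM; not attacked here).**
[cite: BombieriAsymptoticSieve1976] [conjecture] -/
theorem stub_cellParityLaw : CellParityLaw := by
  sorry

/-- **Stub 7 (THE NEW PARITY INPUT; conjectural, crux-grade).** See `LiouvilleTupleMeanPos`; the uncorrected first typing is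
refuted (`not_liouvilleTupleMean_two`). [cite: TaoFMP2016] [conjecture] -/
theorem stub_liouvilleTupleMeanPos : ∀ t : ℕ, 2 ≤ t → LiouvilleTupleMeanPos t := by
  sorry

/-! ## Composition (proved): the line closes the crux modulo its stubs -/

/-- **`PrimeCellsRelative` from the seven stubs**, the landed `stub_roughAnatomy` (p97352) and the proved
`modelCellFacts_proof` (item stmt-Parity-14111). [folklore] -/
theorem PrimeCellsRelative_of : PrimeCellsRelative :=
  stub_chowlaClipsParityPos stub_sieveTransfer stub_walshExtraction stub_singletonClassSums
    (fun t ht => stub_weightedFromMeanPos t (stub_liouvilleTupleMeanPos t ht))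
    Summit.Parity.GeneralizedHardyLittlewood.Theorems.AbsoluteUpgrade.stub_roughAnatomy
    Summit.Parity.GeneralizedHardyLittlewood.Theorems.modelCellFacts_proof stub_cellParityLaw

/-- The same composition in one line through the LANDED line theorem (p119571,
`Theorems/LeeYangFibresPrimeCellsRelativeSieveOutToChowla.lean`). [folklore] -/
theorem PrimeCellsRelative_of' : PrimeCellsRelative :=
  primeCellsRelative_of_cellParityLaw_of_liouvilleTupleMeanPos stub_cellParityLaw stub_liouvilleTupleMeanPos

/-- The same composition through the `t`-LOCAL line theorem (p121321): slice by slice, `t = 1` needing no parity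
input (`liouvilleTupleMeanPos_of_le_one`). [folklore] -/
theorem PrimeCellsRelative_of'' : PrimeCellsRelative :=
  primeCellsRelative_of_cellParityLaw_of_liouvilleTupleMeanPos' stub_cellParityLaw stub_liouvilleTupleMeanPos

/-- **What the two conjectural stubs cost** (hardness certificate, p120414): together they imply Chowla's conjecture
(parity.S06) — through the second one alone. [cite: Chowla1965] -/
theorem chowla_of_stubs : ChowlaConjecture :=
  chowlaConjecture_of_liouvilleTupleMeanPos stub_liouvilleTupleMeanPos

end Summit.Parity.GeneralizedHardyLittlewood.Cruxes.PrimeCellsRelative.SieveOutToChowla.Skeleton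

end
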